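import Summits.Schanuel.Schanuel.Theorems.ZilberEacGraphSurfaceUnbalanced
import HarnessLib

/-!
# Logarithmic strips, VII-a: tilted upper edges and the edge polynomial (combinatorial lemmas)

HONEST FRAMING.  Cell `pub-schanuel` (Zilber's Exponential-Algebraic Closedness, case ladder;
host summit Schanuel), seat 2, gen 18 (HANDOFF O65).  Bookkeeping for
`ZilberEacFibreCurveDegenerate`: for the support of `P ∈ ℂ[x₀, y₀]` (points `(v₁, v₀)` =
(`y`-degree, `x`-degree)), an upper supporting line `v₀ + μv₁ ≤ κ` of NONZERO tilt `μ` exists as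
soon as the row of maximal `x`-degree does not reach the extreme column on one side
(`exists_upper_edge_tilt_right` / `_left`: the least tilt over the points on that side); and two
points of different column on a supporting line make the edge polynomial
`Q_μ = Σ_{v₀ + μv₁ = κ} c_v X^{v₁}` nonzero with a nonzero root (`coeff_edgePoly`,
`exists_root_edgePoly`).  Pure combinatorics/algebra; NOT Schanuel's conjecture (neither used nor
implied; EAC ⇏ SC); `EC(3,2)` stays OPEN.
-/

noncomputable section

open Complex MvPolynomial

set_option linter.dupNamespace false

namespace Summit.Schanuel.Schanuel.Theorems

/-! ## Part A. Tilted upper edges (combinatorics) -/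

/-- **A tilted upper edge, leaning right.**  If `a₀` is a point of maximal height, every other
point of maximal height lies (weakly) to its left, and some point lies strictly to its right, then
there is an upper supporting line of NONZERO tilt through `a₀` and a point of another column.
(new) -/
theorem exists_upper_edge_tilt_right {α : Type*} (A : Finset α) (jf nf : α → ℕ) {a₀ : α}
    (ha₀ : a₀ ∈ A) (htop : ∀ a ∈ A, nf a ≤ nf a₀) (hrow : ∀ a ∈ A, nf a = nf a₀ → jf a ≤ jf a₀)
    (hright : ∃ a ∈ A, jf a₀ < jf a) :
    ∃ μ κ : ℝ, μ ≠ 0 ∧ (∀ a ∈ A, (nf a : ℝ) + μ * jf a ≤ κ) ∧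
      ∃ a ∈ A, ∃ a' ∈ A, jf a ≠ jf a' ∧ (nf a : ℝ) + μ * jf a = κ ∧
        (nf a' : ℝ) + μ * jf a' = κ := by
  classical
  set T := A.filter (fun a => jf a₀ < jf a) with hT
  have hTne : T.Nonempty := by
    obtain ⟨a, ha, hlt⟩ := hright
    exact ⟨a, Finset.mem_filter.2 ⟨ha, hlt⟩⟩
  obtain ⟨as, hasT, hasmin⟩ := T.exists_min_image
    (fun a => ((nf a₀ : ℝ) - nf a) / ((jf a : ℝ) - jf a₀)) hTne
  have hasA : as ∈ A := (Finset.mem_filter.1 hasT).1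
  have hasj : jf a₀ < jf as := (Finset.mem_filter.1 hasT).2
  have hDpos : (0 : ℝ) < (jf as : ℝ) - jf a₀ := by
    have : (jf a₀ : ℝ) < jf as := by exact_mod_cast hasj
    linarith
  have hNlt : nf as < nf a₀ := by
    rcases (htop as hasA).lt_or_eq with h | h
    · exact h
    · exact absurd (hrow as hasA h) (not_le.2 hasj)
  set μ : ℝ := ((nf a₀ : ℝ) - nf as) / ((jf as : ℝ) - jf a₀) with hμ
  have hμpos : 0 < μ := by
    rw [hμ]; refine div_pos ?_ hDpos
    have : (nf as : ℝ) < nf a₀ := by exact_mod_cast hNlt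
    linarith
  refine ⟨μ, (nf a₀ : ℝ) + μ * jf a₀, hμpos.ne', fun a ha => ?_, a₀, ha₀, as, hasA, hasj.ne, rfl,
    ?_⟩
  · have hN : (nf a : ℝ) ≤ nf a₀ := by exact_mod_cast htop a ha
    by_cases h1 : jf a₀ < jf a
    · have haT : a ∈ T := Finset.mem_filter.2 ⟨ha, h1⟩
      have hDa : (0 : ℝ) < (jf a : ℝ) - jf a₀ := by
        have : (jf a₀ : ℝ) < jf a := by exact_mod_cast h1
        linarith
      have hr := hasmin a haT
      have h3 : μ * ((jf a : ℝ) - jf a₀) ≤ (nf a₀ : ℝ) - nf a := by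
        rw [hμ]
        calc ((nf a₀ : ℝ) - nf as) / ((jf as : ℝ) - jf a₀) * ((jf a : ℝ) - jf a₀)
            ≤ ((nf a₀ : ℝ) - nf a) / ((jf a : ℝ) - jf a₀) * ((jf a : ℝ) - jf a₀) :=
              mul_le_mul_of_nonneg_right hr hDa.le
          _ = (nf a₀ : ℝ) - nf a := div_mul_cancel₀ _ hDa.ne'
      linarith
    · have h2 : (jf a : ℝ) ≤ jf a₀ := by exact_mod_cast not_lt.1 h1
      nlinarith
  · have : μ * ((jf as : ℝ) - jf a₀) = (nf a₀ : ℝ) - nf as := by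
      rw [hμ]; exact div_mul_cancel₀ _ hDpos.ne'
    linarith

/-- **A tilted upper edge, leaning left** (mirror image of `exists_upper_edge_tilt_right`).
(new) -/
theorem exists_upper_edge_tilt_left {α : Type*} (A : Finset α) (jf nf : α → ℕ) {a₀ : α}
    (ha₀ : a₀ ∈ A) (htop : ∀ a ∈ A, nf a ≤ nf a₀) (hrow : ∀ a ∈ A, nf a = nf a₀ → jf a₀ ≤ jf a)
    (hleft : ∃ a ∈ A, jf a < jf a₀) :
    ∃ μ κ : ℝ, μ ≠ 0 ∧ (∀ a ∈ A, (nf a : ℝ) + μ * jf a ≤ κ) ∧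
      ∃ a ∈ A, ∃ a' ∈ A, jf a ≠ jf a' ∧ (nf a : ℝ) + μ * jf a = κ ∧
        (nf a' : ℝ) + μ * jf a' = κ := by
  classical
  set T := A.filter (fun a => jf a < jf a₀) with hT
  have hTne : T.Nonempty := by
    obtain ⟨a, ha, hlt⟩ := hleft
    exact ⟨a, Finset.mem_filter.2 ⟨ha, hlt⟩⟩
  obtain ⟨as, hasT, hasmin⟩ := T.exists_min_image
    (fun a => ((nf a₀ : ℝ) - nf a) / ((jf a₀ : ℝ) - jf a)) hTne
  have hasA : as ∈ A := (Finset.mem_filter.1 hasT).1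
  have hasj : jf as < jf a₀ := (Finset.mem_filter.1 hasT).2
  have hDpos : (0 : ℝ) < (jf a₀ : ℝ) - jf as := by
    have : (jf as : ℝ) < jf a₀ := by exact_mod_cast hasj
    linarith
  have hNlt : nf as < nf a₀ := by
    rcases (htop as hasA).lt_or_eq with h | h
    · exact h
    · exact absurd (hrow as hasA h) (not_le.2 hasj)
  set μ : ℝ := -(((nf a₀ : ℝ) - nf as) / ((jf a₀ : ℝ) - jf as)) with hμ
  have hμneg : μ < 0 := by
    rw [hμ, neg_lt_zero]; refine div_pos ?_ hDpos
    have : (nf as : ℝ) < nf a₀ := by exact_mod_cast hNlt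
    linarith
  refine ⟨μ, (nf a₀ : ℝ) + μ * jf a₀, hμneg.ne, fun a ha => ?_, a₀, ha₀, as, hasA, hasj.ne', rfl,
    ?_⟩
  · have hN : (nf a : ℝ) ≤ nf a₀ := by exact_mod_cast htop a ha
    by_cases h1 : jf a < jf a₀
    · have haT : a ∈ T := Finset.mem_filter.2 ⟨ha, h1⟩
      have hDa : (0 : ℝ) < (jf a₀ : ℝ) - jf a := by
        have : (jf a : ℝ) < jf a₀ := by exact_mod_cast h1
        linarith
      have hr := hasmin a haT
      have h3 : -μ * ((jf a₀ : ℝ) - jf a) ≤ (nf a₀ : ℝ) - nf a := by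
        rw [hμ, neg_neg]
        calc ((nf a₀ : ℝ) - nf as) / ((jf a₀ : ℝ) - jf as) * ((jf a₀ : ℝ) - jf a)
            ≤ ((nf a₀ : ℝ) - nf a) / ((jf a₀ : ℝ) - jf a) * ((jf a₀ : ℝ) - jf a) :=
              mul_le_mul_of_nonneg_right hr hDa.le
          _ = (nf a₀ : ℝ) - nf a := div_mul_cancel₀ _ hDa.ne'
      linarith
    · have h2 : (jf a₀ : ℝ) ≤ jf a := by exact_mod_cast not_lt.1 h1
      nlinarith
  · have : -μ * ((jf a₀ : ℝ) - jf as) = (nf a₀ : ℝ) - nf as := by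
      rw [hμ, neg_neg]; exact div_mul_cancel₀ _ hDpos.ne'
    linarith

/-! ## Part B. The edge polynomial: coefficients and a nonzero root -/

section EdgePoly

variable (P : MvPolynomial (Fin 2) ℂ) (μ κ : ℝ)

/-- On an upper supporting line the column determines the point, so the coefficient of the edge
polynomial `Q_μ = Σ_{v₀ + μv₁ = κ} c_v X^{v₁}` in degree `v₁` is `c_v`. [folklore] -/
theorem coeff_edgePoly {v₁ : Fin 2 →₀ ℕ} (hv₁ : v₁ ∈ P.support)
    (hv₁κ : ((v₁ 0 : ℕ) : ℝ) + μ * (v₁ 1 : ℕ) = κ) :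
    (∑ v ∈ P.support.filter (fun v : Fin 2 →₀ ℕ => ((v 0 : ℕ) : ℝ) + μ * (v 1 : ℕ) = κ),
      Polynomial.C (P.coeff v) * Polynomial.X ^ (v 1)).coeff (v₁ 1) = P.coeff v₁ := by
  classical
  have hv₁T : v₁ ∈ P.support.filter (fun v : Fin 2 →₀ ℕ => ((v 0 : ℕ) : ℝ) + μ * (v 1 : ℕ) = κ) :=
    Finset.mem_filter.2 ⟨hv₁, hv₁κ⟩
  rw [Polynomial.finsetSum_coeff, Finset.sum_eq_single v₁]
  · rw [Polynomial.coeff_C_mul, Polynomial.coeff_X_pow, if_pos rfl, mul_one]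
  · intro v hv hne
    rw [Polynomial.coeff_C_mul, Polynomial.coeff_X_pow, if_neg, mul_zero]
    intro h
    apply hne
    obtain ⟨-, hvt⟩ := Finset.mem_filter.1 hv
    have h0 : v 0 = v₁ 0 := by
      rw [← h] at hvt
      have : (v 0 : ℝ) = v₁ 0 := by linarith
      exact_mod_cast this
    ext i
    fin_cases i
    · exact h0
    · exact h.symm
  · intro h; exact (h hv₁T).elim

variable {P μ κ}

/-- Two points of different column on an upper supporting line give a NONZERO edge polynomial
with a NONZERO root. [folklore] -/
theorem exists_root_edgePoly {va vc : Fin 2 →₀ ℕ} (hva : va ∈ P.support) (hvc : vc ∈ P.support)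
    (hne : va 1 ≠ vc 1) (hja : ((va 0 : ℕ) : ℝ) + μ * (va 1 : ℕ) = κ)
    (hjc : ((vc 0 : ℕ) : ℝ) + μ * (vc 1 : ℕ) = κ) :
    ∃ θ : ℂ, θ ≠ 0 ∧
      (∑ v ∈ P.support.filter (fun v : Fin 2 →₀ ℕ => ((v 0 : ℕ) : ℝ) + μ * (v 1 : ℕ) = κ),
        Polynomial.C (P.coeff v) * Polynomial.X ^ (v 1)).eval θ = 0 ∧
      (∑ v ∈ P.support.filter (fun v : Fin 2 →₀ ℕ => ((v 0 : ℕ) : ℝ) + μ * (v 1 : ℕ) = κ),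
        Polynomial.C (P.coeff v) * Polynomial.X ^ (v 1)) ≠ 0 := by
  set Q := ∑ v ∈ P.support.filter (fun v : Fin 2 →₀ ℕ => ((v 0 : ℕ) : ℝ) + μ * (v 1 : ℕ) = κ),
    Polynomial.C (P.coeff v) * Polynomial.X ^ (v 1) with hQ
  have hca : Q.coeff (va 1) ≠ 0 := by
    rw [hQ, coeff_edgePoly P μ κ hva hja]; exact MvPolynomial.mem_support_iff.1 hva
  have hcc : Q.coeff (vc 1) ≠ 0 := by
    rw [hQ, coeff_edgePoly P μ κ hvc hjc]; exact MvPolynomial.mem_support_iff.1 hvc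
  have hQ0 : Q ≠ 0 := fun h => hca (by rw [h, Polynomial.coeff_zero])
  rcases lt_or_gt_of_ne hne with hlt | hgt
  · obtain ⟨θ, hθ0, hθ⟩ := exists_root_ne_zero_of_coeff_ne_zero (vc 1) Q (va 1) hlt hca hcc
    exact ⟨θ, hθ0, hθ, hQ0⟩
  · obtain ⟨θ, hθ0, hθ⟩ := exists_root_ne_zero_of_coeff_ne_zero (va 1) Q (vc 1) hgt hcc hca
    exact ⟨θ, hθ0, hθ, hQ0⟩

end EdgePoly

end Summit.Schanuel.Schanuel.Theorems
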